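import Summits.ResolutionOfSingularities.ResolutionOfSingularities.Theorems.FrobeniusClosingPatchingRelPerfectMonomialRouteKAtlas
import Literature.AlgebraicGeometry.Resolution.CoordinateBlowupChart
import Literature.AlgebraicGeometry.Resolution.BlowupPrincipalCharts
import Literature.AlgebraicGeometry.Resolution.BlowupCharts
import Literature.AlgebraicGeometry.Resolution.BlowupChartMembership
import Literature.AlgebraicGeometry.Resolution.BlowupsLocal
import HarnessLib

/-!
# Crux `PatchingRelPerfect` (stmt-ResolutionOfSingularities-16161), chain w52 — TargetsF3 (m)
# «M2-strong», COMBINATORIAL HALF, Route K step K11: the CHARTS OF THE BLOW-UP of a toric chart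
# along a coordinate stratum, and of a toric chart missing the centre

[OURS · L1 W5.2 · design memo v3 (`L/res-type-075/M2STRONG-COMBINATORIAL-HALF.md`); fact-free;
nothing here is a statement of the manuscript under review]

Let `π : Y' → Y` be a blowing up along `C` (universal property, tree `IsBlowup`) and `c` a toric
chart of `Y` (file K8: affine open `U`, `e : Γ(Y, U) ≅ ℚ[x_{B₀}]`).

* **`exists_chartFamily`** — if `C` is read in `c` as the coordinate stratum `(x_i : i ∈ S)`, then
  for every `j ∈ S` there is an open immersion `g_j : Spec ℚ[x] → Y'` with
  `g_j ≫ π = Spec (subst_j ∘ e) ≫ (Spec Γ(Y,U) → Y)`, `subst_j` being Hu's substitution `x_i ↦ x_j x_i`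
  (`i ∈ S ∖ j`) of the tree's `CoordinateBlowupChart.lean`; the `g_j` cover `π⁻¹(U)`; and the
  TRANSITION: a point of the `i`-th chart at which `x_j` is invertible lies in the `j`-th chart.
  (Uniqueness of blowing ups identifies `π⁻¹(U)` with `Proj` of the Rees algebra of `(x_S) ⊆ ℚ[x]`,
  whose charts `D₊(x_j t)` are `Spec ℚ[x]` by `coordBlowupReesChartEquiv`; the transition is the
  universal property applied to the explicit transition substitution.)
* **`exists_liftChart`** — if `C` does not meet `U` (`e(C(U)) = ⊤`), then `π⁻¹(U) ≅ U` and there is an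
  open immersion `g : Spec ℚ[x] → Y'` onto `π⁻¹(U)` with `g ≫ π = Spec e ≫ (Spec Γ(Y,U) → Y)`.
* `Chart.ofMap` — the toric chart of `Y'` defined by such a `g` (affine open `g(Spec ℚ[x])`, sections
  `Γ(Y', g(Spec ℚ[x])) ≅ ℚ[x]`), with **`img_ofMap_comap`**: an ideal sheaf `K` of `Y` pulled back to
  `Y'` is read in the new chart as `ρ(e(K(U)))·ℚ[x]`, `ρ` the substitution (tree
  `appLE_appIso_ΓSpecIso_of_comp_eq`).
-/

-- `Summit.<Summit>.<Sub>.Theorems` with `Sub = Summit` (single-conjunct summit, D-0017)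
set_option linter.dupNamespace false

noncomputable section

open CategoryTheory AlgebraicGeometry TopologicalSpace
open Literature.AlgebraicGeometry.Resolution

namespace Summit.ResolutionOfSingularities.ResolutionOfSingularities.Theorems

namespace PolyhedraGame

namespace RouteK

variable {L : Finset ℕ}

/-- [OURS] Notation: the polynomial ring of the charts as an object of `CommRingCat`. -/
abbrev Rc (L : Finset ℕ) : CommRingCat.{0} := CommRingCat.of (MvPolynomial L ℚ)

/-! ## The chart defined by an open immersion `Spec ℚ[x] → Y'` over a chart of `Y` -/

namespace Chart

variable {Y Y' : Scheme.{0}} (c : Chart L Y)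

/-- [OURS · Route K] The toric chart of `Y'` defined by an open immersion `g : Spec ℚ[x] → Y'` and a
labelling: the affine open `g(Spec ℚ[x])` with sections `Γ(Y', g(Spec ℚ[x])) ≅ Γ(Spec ℚ[x], ⊤) ≅ ℚ[x]`. -/
def ofMap (lab : ℕ → ℕ) (g : Spec (Rc L) ⟶ Y') [IsOpenImmersion g] : Chart L Y' where
  lab := lab
  U := ⟨g ''ᵁ ⊤, (isAffineOpen_top _).image_of_isOpenImmersion g⟩
  e := ((g.appIso ⊤) ≪≫ Scheme.ΓSpecIso (Rc L)).commRingCatIsoToRingEquiv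

/-- [OURS] Unfolding. -/
@[simp] theorem ofMap_lab (lab : ℕ → ℕ) (g : Spec (Rc L) ⟶ Y') [IsOpenImmersion g] :
    (ofMap lab g).lab = lab := rfl

/-- [OURS] Unfolding. -/
theorem ofMap_U (lab : ℕ → ℕ) (g : Spec (Rc L) ⟶ Y') [IsOpenImmersion g] :
    ((ofMap lab g).U : Y'.Opens) = g ''ᵁ ⊤ := rfl

/-- [OURS] The points of the new chart are the image of `g`. -/
theorem mem_ofMap_U_iff (lab : ℕ → ℕ) (g : Spec (Rc L) ⟶ Y') [IsOpenImmersion g] (y : Y') :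
    y ∈ ((ofMap lab g).U : Y'.Opens) ↔ y ∈ Set.range g := by
  rw [ofMap_U, ← Scheme.Hom.coe_opensRange, Scheme.Hom.image_top_eq_opensRange]
  rfl

/-- [OURS · Route K] **Reading a pulled-back ideal sheaf in the new chart**: if
`g ≫ π = Spec (ρ ∘ e) ≫ (Spec Γ(Y,U) → Y)` for a ring map `ρ : ℚ[x] → ℚ[x]`, then for every ideal sheaf
`K` on `Y`, the chart `ofMap lab g` reads `π^* K` as `ρ(e(K(U))) · ℚ[x]`. -/
theorem img_ofMap_comap {π : Y' ⟶ Y} (lab : ℕ → ℕ) (g : Spec (Rc L) ⟶ Y') [IsOpenImmersion g]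
    (ρ : MvPolynomial L ℚ →+* MvPolynomial L ℚ)
    (hg : g ≫ π = Spec.map (CommRingCat.ofHom (ρ.comp (c.e : Γ(Y, c.U) →+* MvPolynomial L ℚ))) ≫
      c.U.2.fromSpec)
    (K : Y.IdealSheafData) : (ofMap lab g).img (K.comap π) = (c.img K).map ρ := by
  have hVU : g ''ᵁ ⊤ ≤ π ⁻¹ᵁ (c.U : Y.Opens) := image_top_le_preimage_of_comp_eq π g c.U _ hg
  have key := appLE_appIso_ΓSpecIso_of_comp_eq π g c.U _ hg hVU
  -- sections of `π^* K` on the new chart are `K(U)` extended along `π^*`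
  have hsec : (K.comap π).ideal (ofMap lab g).U = (K.ideal c.U).map (π.appLE c.U (g ''ᵁ ⊤) hVU).hom :=
    ideal_comap_of_le π K c.U (ofMap lab g).U hVU
  have hpt : ∀ a, (ofMap lab g).e ((π.appLE c.U (g ''ᵁ ⊤) hVU).hom a) = ρ (c.e a) := fun a =>
    congrArg (fun φ : Γ(Y, c.U) ⟶ Rc L => φ.hom a) key
  have hcomp : ((ofMap lab g).e : Γ(Y', (ofMap lab g).U) →+* MvPolynomial L ℚ).comp
      (π.appLE c.U (g ''ᵁ ⊤) hVU).hom = ρ.comp (c.e : Γ(Y, c.U) →+* MvPolynomial L ℚ) :=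
    RingHom.ext hpt
  unfold Chart.img
  rw [hsec]
  have h1 : ((K.ideal c.U).map (π.appLE c.U (g ''ᵁ ⊤) hVU).hom).map
      ((ofMap lab g).e : Γ(Y', (ofMap lab g).U) →+* MvPolynomial L ℚ) =
      (K.ideal c.U).map (((ofMap lab g).e : Γ(Y', (ofMap lab g).U) →+* MvPolynomial L ℚ).comp
        (π.appLE c.U (g ''ᵁ ⊤) hVU).hom) := Ideal.map_map _ _
  refine h1.trans ?_
  rw [hcomp, ← Ideal.map_map]

end Chart

/-! ## The charts of the blow-up of a toric chart along a coordinate stratum -/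

section Family

variable {Y Y' : Scheme.{0}} {π : Y' ⟶ Y} {C : Y.IdealSheafData} (c : Chart L Y)

/-- [OURS] The localization `ℚ[x][1/x_j]` (the overlap of the `i`-chart with the `j`-chart, in the
coordinates of the `i`-chart... read in the `j`-chart it is where `x_j` is invertible). -/
abbrev Rloc (j : L) : Type := Localization.Away (MvPolynomial.X j : MvPolynomial L ℚ)

/-- [OURS] The transition substitution from the `j`-chart to the `i`-chart of the blow-up of `ℚ[x]`
along `(x_S)`: `x_j ↦ x_i x_j`, `x_i ↦ 1/x_j`, `x_k ↦ x_k / x_j` (`k ∈ S ∖ {i, j}`), `x_b ↦ x_b`. -/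
def transition (S : Finset L) (i j : L) : MvPolynomial L ℚ →+* Rloc (L := L) j :=
  (MvPolynomial.aeval fun k : L =>
    if k = j then algebraMap (MvPolynomial L ℚ) (Rloc (L := L) j) (MvPolynomial.X i * MvPolynomial.X j)
    else if k = i then IsLocalization.Away.invSelf (S := Rloc (L := L) j) (MvPolynomial.X j : MvPolynomial L ℚ)
    else if k ∈ S then algebraMap (MvPolynomial L ℚ) (Rloc (L := L) j) (MvPolynomial.X k) *
      IsLocalization.Away.invSelf (S := Rloc (L := L) j) (MvPolynomial.X j : MvPolynomial L ℚ)
    else algebraMap (MvPolynomial L ℚ) (Rloc (L := L) j) (MvPolynomial.X k)).toRingHom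

/-- [OURS] The transition substitution on variables. -/
theorem transition_X (S : Finset L) (i j k : L) :
    transition S i j (MvPolynomial.X k) =
      if k = j then algebraMap (MvPolynomial L ℚ) (Rloc (L := L) j) (MvPolynomial.X i * MvPolynomial.X j)
      else if k = i then IsLocalization.Away.invSelf (S := Rloc (L := L) j) (MvPolynomial.X j : MvPolynomial L ℚ)
      else if k ∈ S then algebraMap (MvPolynomial L ℚ) (Rloc (L := L) j) (MvPolynomial.X k) *
        IsLocalization.Away.invSelf (S := Rloc (L := L) j) (MvPolynomial.X j : MvPolynomial L ℚ)
      else algebraMap (MvPolynomial L ℚ) (Rloc (L := L) j) (MvPolynomial.X k) := by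
  simp [transition]

/-- [OURS] The transition substitution on constants. -/
theorem transition_C (S : Finset L) (i j : L) (q : ℚ) :
    transition S i j (MvPolynomial.C q) = algebraMap (MvPolynomial L ℚ) (Rloc (L := L) j) (MvPolynomial.C q) := by
  simp only [transition, AlgHom.toRingHom_eq_coe, AlgHom.coe_toRingHom, MvPolynomial.algHom_C]
  exact (IsScalarTower.algebraMap_apply ℚ (MvPolynomial L ℚ) (Rloc (L := L) j) q)

/-- [OURS] The transition substitution intertwines the two chart substitutions:
`τ ∘ subst_j = (ℚ[x] → ℚ[x][1/x_j]) ∘ subst_i`. -/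
theorem transition_comp_subst (S : Finset L) {i j : L} (hi : i ∈ S) (hj : j ∈ S) (hij : i ≠ j) :
    (transition S i j).comp (coordBlowupSubst ℚ (S : Set L) j).toRingHom =
      (algebraMap (MvPolynomial L ℚ) (Rloc (L := L) j)).comp (coordBlowupSubst ℚ (S : Set L) i).toRingHom := by
  have hinv : algebraMap (MvPolynomial L ℚ) (Rloc (L := L) j) (MvPolynomial.X j) *
      IsLocalization.Away.invSelf (S := Rloc (L := L) j) (MvPolynomial.X j : MvPolynomial L ℚ) = 1 :=
    IsLocalization.Away.mul_invSelf (MvPolynomial.X j : MvPolynomial L ℚ)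
  apply MvPolynomial.ringHom_ext
  · intro q
    simp only [RingHom.comp_apply, AlgHom.toRingHom_eq_coe, AlgHom.coe_toRingHom, coordBlowupSubst_C]
    exact transition_C S i j q
  · intro k
    simp only [RingHom.comp_apply, AlgHom.toRingHom_eq_coe, AlgHom.coe_toRingHom]
    by_cases hkj : k = j
    · subst hkj
      rw [coordBlowupSubst_X_self,
        coordBlowupSubst_X_of_mem_of_ne ℚ (S : Set L) i (Finset.mem_coe.mpr hj) (Ne.symm hij),
        transition_X, if_pos rfl]
    · by_cases hki : k = i
      · subst hki
        rw [coordBlowupSubst_X_self, coordBlowupSubst_X_of_mem_of_ne ℚ (S : Set L) j (Finset.mem_coe.mpr hi) hij,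
          map_mul, transition_X, if_pos rfl, transition_X, if_neg hij, if_pos rfl, map_mul]
        rw [mul_assoc, hinv, mul_one]
      · by_cases hkS : k ∈ S
        · rw [coordBlowupSubst_X_of_mem_of_ne ℚ (S : Set L) j (Finset.mem_coe.mpr hkS) hkj,
            coordBlowupSubst_X_of_mem_of_ne ℚ (S : Set L) i (Finset.mem_coe.mpr hkS) hki, map_mul, map_mul,
            transition_X, if_pos rfl, transition_X, if_neg hkj, if_neg hki, if_pos hkS, map_mul]
          -- `(x_i x_j) · (x_k / x_j) = x_i x_k`
          calc algebraMap _ (Rloc (L := L) j) (MvPolynomial.X i) * algebraMap _ _ (MvPolynomial.X j) *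
                (algebraMap _ _ (MvPolynomial.X k) * IsLocalization.Away.invSelf (S := Rloc (L := L) j) (MvPolynomial.X j : MvPolynomial L ℚ))
              = algebraMap _ _ (MvPolynomial.X i) * algebraMap _ _ (MvPolynomial.X k) *
                  (algebraMap _ _ (MvPolynomial.X j) * IsLocalization.Away.invSelf (S := Rloc (L := L) j) (MvPolynomial.X j : MvPolynomial L ℚ)) := by
                ring
            _ = algebraMap _ _ (MvPolynomial.X i) * algebraMap _ _ (MvPolynomial.X k) := by
                rw [hinv, mul_one]
        · have hkS' : k ∉ (S : Set L) := fun h => hkS (Finset.mem_coe.mp h)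
          rw [coordBlowupSubst_X_of_not_mem ℚ (S : Set L) _ hkS', coordBlowupSubst_X_of_not_mem ℚ (S : Set L) _ hkS',
            transition_X, if_neg hkj, if_neg hki, if_neg hkS]

/-- [OURS] Range of the family `(x_j)_{j ∈ S}` is the image of `S`. -/
theorem range_X_subtype (S : Finset L) :
    Set.range (fun j : S => (MvPolynomial.X (j : L) : MvPolynomial L ℚ)) = MvPolynomial.X '' (S : Set L) := by
  ext f
  constructor
  · rintro ⟨⟨j, hj⟩, rfl⟩; exact ⟨j, hj, rfl⟩
  · rintro ⟨j, hj, rfl⟩; exact ⟨⟨j, hj⟩, rfl⟩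

/-- [OURS · W5.2 M2-strong · Route K, K11] **The charts of the blow-up of a toric chart along a
coordinate stratum.**  If the centre `C` is read in the chart `c` as `(x_i : i ∈ S)`, then for every
`j ∈ S` there is an open immersion `g_j : Spec ℚ[x] → Y'` with `g_j ≫ π = Spec (subst_j ∘ e) ≫ (Spec Γ(Y,U) → Y)`;
the `g_j` cover `π⁻¹(U)`; and a point of the `i`-chart at which `x_j` is invertible lies in the
`j`-chart. -/
theorem exists_chartFamily (hπ : IsBlowup π C) (S : Finset L) (hS : c.img C = coordIdeal S) :
    ∃ g : S → (Spec (Rc L) ⟶ Y'),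
      (∀ j, IsOpenImmersion (g j)) ∧
      (∀ j, g j ≫ π = Spec.map (CommRingCat.ofHom ((coordBlowupSubst ℚ (S : Set L) (j : L)).toRingHom.comp
          (c.e : Γ(Y, c.U) →+* MvPolynomial L ℚ))) ≫ c.U.2.fromSpec) ∧
      (∀ y' : Y', π y' ∈ (c.U : Y.Opens) → ∃ j, y' ∈ Set.range (g j)) ∧
      (∀ (i j : S) (z : Spec (Rc L)), (MvPolynomial.X (j : L) : MvPolynomial L ℚ) ∉ z.asIdeal →
          g i z ∈ Set.range (g j)) := by
  -- the centre ideal in the chart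
  let I₀ : Ideal (MvPolynomial L ℚ) := Ideal.span (MvPolynomial.X '' (S : Set L))
  have hI₀ : (C.ideal c.U).map (c.e : Γ(Y, c.U) →+* MvPolynomial L ℚ) = I₀ := hS
  -- the base isomorphism `Spec ℚ[x] ≅ Spec Γ(Y, U)`
  let eIso : Γ(Y, c.U) ≅ Rc L := c.e.toCommRingCatIso
  let sE : Spec (Rc L) ≅ Spec Γ(Y, c.U) := Scheme.Spec.mapIso eIso.op
  have sE_hom : sE.hom = Spec.map (CommRingCat.ofHom (c.e : Γ(Y, c.U) →+* MvPolynomial L ℚ)) := rfl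
  -- `π⁻¹(U)` is a blowing up of `Spec ℚ[x]` along `(x_S)`
  have h2 := (hπ.restrict_isoSpec c.U).comp_iso sE.symm
  have hideal : (affineBlowup.idealSheaf (C.ideal c.U)).comap sE.symm.inv = affineBlowup.idealSheaf I₀ := by
    change (affineBlowup.idealSheaf (C.ideal c.U)).comap sE.hom = _
    rw [sE_hom, affineBlowup.comap_idealSheaf_specMap, hI₀]
  rw [hideal] at h2
  obtain ⟨ε, -, hε'⟩ := h2.unique (affineBlowup.isBlowup I₀)
  -- `ε.inv ≫ (π∣_U) = affineBlowup.π ≫ Spec e ≫ isoSpec.inv`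
  have hεπ : ε.inv ≫ (π ∣_ (c.U : Y.Opens)) =
      affineBlowup.π I₀ ≫ sE.hom ≫ c.U.2.isoSpec.inv := by
    have := hε'
    rw [Iso.symm_hom] at this
    rw [← this]
    simp only [Category.assoc, Iso.inv_hom_id_assoc, Iso.hom_inv_id, Category.comp_id]
  -- the charts
  have hjI : ∀ j : S, (MvPolynomial.X (j : L) : MvPolynomial L ℚ) ∈ I₀ := fun j =>
    X_mem_span_image ℚ (S : Set L) (j : L) (Finset.mem_coe.mpr j.2)
  let A : S → Type := fun j => HomogeneousLocalization.Away (reesGrading I₀) (reesT (MvPolynomial.X (j : L)) (hjI j))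
  let κ : ∀ j : S, A j ≃+* MvPolynomial L ℚ := fun j =>
    coordBlowupReesChartEquiv ℚ (S : Set L) (j : L) (Finset.mem_coe.mpr j.2)
  let κIso : ∀ j : S, CommRingCat.of (A j) ≅ Rc L := fun j => (κ j).toCommRingCatIso
  let ch : ∀ j : S, Spec (CommRingCat.of (A j)) ⟶ affineBlowup I₀ := fun j =>
    affineBlowup.chartι (I := I₀) (MvPolynomial.X (j : L)) (hjI j)
  let sκ : ∀ j : S, Spec (Rc L) ⟶ Spec (CommRingCat.of (A j)) := fun j => Spec.map (κIso j).hom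
  let sκ' : ∀ j : S, Spec (CommRingCat.of (A j)) ⟶ Spec (Rc L) := fun j => Spec.map (κIso j).inv
  have hκκ : ∀ (j : S) (z), sκ j (sκ' j z) = z := by
    intro j z
    simp only [sκ, sκ']
    rw [← Scheme.Hom.comp_apply, ← Spec.map_comp, Iso.hom_inv_id, Spec.map_id]
    rfl
  let g : S → (Spec (Rc L) ⟶ Y') := fun j => sκ j ≫ ch j ≫ ε.inv ≫ (π ⁻¹ᵁ (c.U : Y.Opens)).ι
  have hopen : ∀ j, IsOpenImmersion (g j) := fun j => by simp only [g, sκ]; infer_instance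
  have hgπ : ∀ j, g j ≫ π = Spec.map (CommRingCat.ofHom ((coordBlowupSubst ℚ (S : Set L) (j : L)).toRingHom.comp
      (c.e : Γ(Y, c.U) →+* MvPolynomial L ℚ))) ≫ c.U.2.fromSpec := by
    intro j
    simp only [g, sκ, Category.assoc]
    rw [← morphismRestrict_ι, ← Category.assoc ε.inv, hεπ]
    simp only [Category.assoc, IsAffineOpen.isoSpec_inv_ι]
    rw [← Category.assoc (ch j), affineBlowup.chartι_π, sE_hom, ← Spec.map_comp_assoc, ← Spec.map_comp_assoc]
    congr 2
    ext x : 2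
    change κ j (reesChartBase _ _ (c.e x)) = coordBlowupSubst ℚ (S : Set L) (j : L) (c.e x)
    exact coordBlowupReesChartEquiv_reesChartBase ℚ (S : Set L) (j : L) _ (c.e x)
  have hcover : ∀ y' : Y', π y' ∈ (c.U : Y.Opens) → ∃ j, y' ∈ Set.range (g j) := by
    intro y' hy'
    let u : ↥(π ⁻¹ᵁ (c.U : Y.Opens)) := ⟨y', hy'⟩
    have hu : ε.hom u ∈ (⊤ : (affineBlowup I₀).Opens) := trivial
    rw [← affineBlowup.iSup_chartOpen_eq_top (I := I₀) (fun j : S => (MvPolynomial.X (j : L) : MvPolynomial L ℚ))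
      (by rw [range_X_subtype]), Opens.mem_iSup] at hu
    obtain ⟨j, hj⟩ := hu
    change ε.hom u ∈ (affineBlowup.chartι (I := I₀) (MvPolynomial.X (j : L)) (hjI j)) ''ᵁ ⊤ at hj
    obtain ⟨z, -, hz⟩ := hj
    replace hz : (affineBlowup.chartι (I := I₀) (MvPolynomial.X (j : L)) (hjI j)) z = ε.hom u := hz
    refine ⟨j, sκ' j z, ?_⟩
    simp only [g, Scheme.Hom.comp_apply]
    rw [hκκ]
    change (π ⁻¹ᵁ (c.U : Y.Opens)).ι (ε.inv (affineBlowup.chartι _ _ z)) = y'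
    rw [hz, ← Scheme.Hom.comp_apply ε.hom ε.inv, Iso.hom_inv_id]
    rfl
  clear_value g
  refine ⟨g, hopen, hgπ, hcover, ?_⟩
  -- transition
  intro i j z hz
  by_cases hij : (i : L) = j
  · have : i = j := Subtype.ext hij
    subst this
    exact ⟨z, rfl⟩
  let α : Spec (CommRingCat.of (Rloc (L := L) (j : L))) ⟶ Spec (Rc L) :=
    Spec.map (CommRingCat.ofHom (algebraMap (MvPolynomial L ℚ) (Rloc (L := L) (j : L))))
  let β : Spec (CommRingCat.of (Rloc (L := L) (j : L))) ⟶ Spec (Rc L) :=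
    Spec.map (CommRingCat.ofHom (transition S (i : L) (j : L)))
  -- the two maps agree after `π`
  have hcomp : (α ≫ g i) ≫ π = (β ≫ g j) ≫ π := by
    simp only [Category.assoc, hgπ, α, β]
    rw [← Spec.map_comp_assoc, ← Spec.map_comp_assoc, ← CommRingCat.ofHom_comp, ← CommRingCat.ofHom_comp,
      ← RingHom.comp_assoc, ← RingHom.comp_assoc, transition_comp_subst S i.2 j.2 hij]
  -- the centre pulls back to the principal ideal `(x_i)` of the domain `ℚ[x][1/x_j]`
  have hsubi : I₀.map (coordBlowupSubst ℚ (S : Set L) (i : L)).toRingHom =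
      Ideal.span {(MvPolynomial.X (i : L) : MvPolynomial L ℚ)} :=
    map_coordBlowupSubst_span_eq ℚ (S : Set L) (i : L) (Finset.mem_coe.mpr i.2)
  have hnzd : algebraMap (MvPolynomial L ℚ) (Rloc (L := L) (j : L)) (MvPolynomial.X (i : L)) ∈
      nonZeroDivisors (Rloc (L := L) (j : L)) := by
    refine mem_nonZeroDivisors_of_ne_zero ?_
    rw [Ne, IsLocalization.map_eq_zero_iff (Submonoid.powers (MvPolynomial.X (j : L) : MvPolynomial L ℚ))]
    rintro ⟨⟨m, hm⟩, hm0⟩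
    obtain ⟨n, rfl⟩ := (Submonoid.mem_powers_iff _ _).mp hm
    exact MvPolynomial.X_ne_zero (R := ℚ) (i : L)
      ((mul_eq_zero.mp hm0).resolve_left (pow_ne_zero n (MvPolynomial.X_ne_zero _)))
  have hcart : IsEffectiveCartier (C.comap ((α ≫ g i) ≫ π)) := by
    rw [Category.assoc, hgπ]
    simp only [α]
    rw [← Spec.map_comp_assoc, ← CommRingCat.ofHom_comp, Scheme.IdealSheafData.comap_comp,
      comap_fromSpec, affineBlowup.comap_idealSheaf_specMap, ← Ideal.map_map, ← Ideal.map_map, hI₀, hsubi,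
      Ideal.map_span, Set.image_singleton]
    exact affineBlowup.isEffectiveCartier_idealSheaf_span_singleton hnzd
  have heq : α ≫ g i = β ≫ g j := hπ.hom_ext hcart hcomp
  -- `z` lies in the image of `α`
  have hz' : z ∈ α.opensRange := by
    change z ∈ (Spec.map (CommRingCat.ofHom (algebraMap (Rc L) (Localization.Away _)))).opensRange
    rw [Scheme.Hom.opensRange_localizationAway]
    exact hz
  obtain ⟨w, rfl⟩ := hz'
  refine ⟨β w, ?_⟩
  rw [← Scheme.Hom.comp_apply, ← heq, Scheme.Hom.comp_apply]

/-- [OURS · W5.2 M2-strong · Route K, K11] **The lifted chart of a toric chart missing the centre**: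
if `C` is read in `c` as the unit ideal, `π` is an isomorphism over `U` and there is an open immersion
`g : Spec ℚ[x] → Y'` onto `π⁻¹(U)` with `g ≫ π = Spec e ≫ (Spec Γ(Y,U) → Y)`. -/
theorem exists_liftChart (hπ : IsBlowup π C) (htop : c.img C = ⊤) :
    ∃ g : Spec (Rc L) ⟶ Y', IsOpenImmersion g ∧
      g ≫ π = Spec.map (CommRingCat.ofHom ((RingHom.id _).comp (c.e : Γ(Y, c.U) →+* MvPolynomial L ℚ))) ≫
        c.U.2.fromSpec ∧
      ∀ y' : Y', π y' ∈ (c.U : Y.Opens) → y' ∈ Set.range g := by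
  -- `U` misses the centre
  have hU : Disjoint ((c.U : Y.Opens) : Set Y) (C.support : Set Y) := by
    rw [Set.disjoint_left]
    intro y hy hyC
    obtain ⟨P, hP, rfl⟩ := Good.exists_point_eq c hy
    have h1 := (c.point_mem_support_iff P C).mp hyC
    rw [htop, top_le_iff] at h1
    exact hP.ne_top h1
  haveI : IsIso (π ∣_ (c.U : Y.Opens)) := hπ.isIso_morphismRestrict hU
  let eIso : Γ(Y, c.U) ≅ Rc L := c.e.toCommRingCatIso
  let g : Spec (Rc L) ⟶ Y' :=
    Spec.map eIso.hom ≫ c.U.2.isoSpec.inv ≫ inv (π ∣_ (c.U : Y.Opens)) ≫ (π ⁻¹ᵁ (c.U : Y.Opens)).ι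
  refine ⟨g, by simp only [g]; infer_instance, ?_, ?_⟩
  · simp only [g, Category.assoc]
    rw [← morphismRestrict_ι, IsIso.inv_hom_id_assoc, IsAffineOpen.isoSpec_inv_ι, RingHom.id_comp]
    rfl
  · intro y' hy'
    let u : ↥(π ⁻¹ᵁ (c.U : Y.Opens)) := ⟨y', hy'⟩
    refine ⟨Spec.map eIso.inv (c.U.2.isoSpec.hom ((π ∣_ (c.U : Y.Opens)) u)), ?_⟩
    have key : (π ∣_ (c.U : Y.Opens)) ≫ c.U.2.isoSpec.hom ≫ Spec.map eIso.inv ≫ g = (π ⁻¹ᵁ (c.U : Y.Opens)).ι := by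
      simp only [g, ← Spec.map_comp_assoc, Iso.hom_inv_id, Spec.map_id, Category.id_comp, Iso.hom_inv_id_assoc,
        IsIso.hom_inv_id_assoc]
    change _ = (π ⁻¹ᵁ (c.U : Y.Opens)).ι u
    rw [← key]
    simp only [Scheme.Hom.comp_apply]

end Family

end RouteK

end PolyhedraGame

end Summit.ResolutionOfSingularities.ResolutionOfSingularities.Theorems

end
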